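import Mathlib
import HarnessLib
import Summits.HubbardSuperconductivity.HubbardSuperconductivity.Theorems.KLProgrammeC4aFoldCurvaturePartnerBand
import Summits.HubbardSuperconductivity.HubbardSuperconductivity.Theorems.KLProgrammeC4aCausticTouchConvexity

/-!
# Route `KLProgramme` — crux C4a, S3 brick (B4) «(B4)-UMK1», «(M2)-HESSIAN» part 1 (carrier-free): the JOINT second derivative of a two-curve
# composition `(ϑ,φ) ↦ f(c + Γ₁(ϑ+θ) − Γ₂(φ+θ))` along segments, its comparison with the ANTIPODAL reference jet on the zero level of `f`
# (value `Q·(2u² + 2uv + 2v²)`, `Q = D²f(Γ₀ψ)[Γ₀′ψ, Γ₀′ψ]`), the robust Schur floor `(3Q/2 − 2ε)u²`, and hence JOINT STRONG CONVEXITY in `ϑ` on a convex set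

Cell `gate-hubbard-kl`, seat hubbard-kl-k3c3-p3 (g29; row «implicit-function / monotonicity route for μ(n)»).  Located brick for the (C)-closer lane hubbard-kl-c4a-1
(stub (C) `stub_twoLeg_curvature` of `KLRegimeEngineV17F2`, stmt-HubbardSuperconductivity-20437), memo HOME/hubbard-kl-k3c3-p3/U1-CAUSTIC-SUP.md §3 / §7 REMAINING (M2)
first half: «joint strong convexity of `(ϑ,φ) ↦ e_K(k + q′(ϑ) − 2πm − Φ(0,φ+θ))` on a neighbourhood of an antipodal-umklapp configuration, modulus `κ ≥ κ_min > 0`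
(Hessian `det = κ²Q_p² + 2λQ_pQ′`)».  The form in which `…C4aCausticTouchConvexity.convexOn_sub_sq_of_line_deriv2` wants it is a DIRECTIONAL floor
`κ(q₁ − p₁)² ≤ ∂ₛ²` along segments.  With `G(ϑ,φ) = f(c + Γ₁(ϑ+θ) − Γ₂(φ+θ))` (`f = e_K`, `Γ₁ = Φ(ρ,·)` the `q′`-curve, `Γ₂ = Φ(0,·)` the loop curve,
`c = k − v_m`) and the antipodal reference on the Fermi curve (`P ≈ Γ₀ψ`, `Γ₁′ ≈ −Γ₀′ψ`, `Γ₂′ ≈ Γ₀′ψ`, same for second derivatives; `f ∘ Γ₀ ≡ 0`):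
* §1 `iteratedDeriv_comp_const_add_mul` (affine reparametrisation), **`iteratedDeriv_two_comp_two_curves`**:
  `∂ₛ² f(c + Γ₁(a₁+us) − Γ₂(a₂+vs)) = D²f(P)[w′,w′] + Df(P)[w″]`, `w′ = uΓ₁′ − vΓ₂′`, `w″ = u²Γ₁″ − v²Γ₂″`;
* §2 `antipodal_reference_jet_eq` (the reference value is `Q(2u² + 2uv + 2v²)`: `(u+v)²Q − (u²+v²)Df[Γ₀″] = (u+v)²Q + (u²+v²)Q`),
  **`abs_iteratedDeriv_two_two_curves_sub_le`**: `|∂ₛ² − Q(2u²+2uv+2v²)| ≤ ε(u²+v²)`, `ε = 2K₃ΔD₁² + 4K₂δD₁ + K₂ΔD₂ + K₁η` from the displacement rows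
  `‖P − Γ₀ψ‖ ≤ Δ`, `‖Γ₁′ + Γ₀′ψ‖, ‖Γ₂′ − Γ₀′ψ‖ ≤ δ`, `‖Γ₁″ + Γ₀″ψ‖, ‖Γ₂″ − Γ₀″ψ‖ ≤ η` (one call of `…TangencyCalculusTwo.abs_jet_two_sub_le`);
* §3 `robust_schur_floor`: `0 < Q`, `0 ≤ ε ≤ 3Q/2`, `|T − Q(2u²+2uv+2v²)| ≤ ε(u²+v²)` ⟹ `(3Q/2 − 2ε)u² ≤ T` (Schur complement `2Q − Q²/2Q = 3Q/2` of
  `[[2Q,Q],[Q,2Q]]`, robust under an `ε`-perturbation: `(2Q−ε)·[(Q/2+ε)u² + 2Quv + (2Q−ε)v²] = ((2Q−ε)v + Qu)² + ε(3Q/2−ε)u²`);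
* §4 **`convexOn_sub_sq_of_two_curves`**: on a convex `S ⊆ ℝ×ℝ` where the rows hold at every `(ϑ+θ, φ+θ)`, `(ϑ,φ) ∈ S`:
  `ConvexOn ℝ S (G − (κ/2)ϑ²)` with `κ = 3Q/2 − 2ε` — the `hg` of `convexOn_partialMin_sub_sq`, hence (part 1 of «(M2)-DISPATCH») the `hφ` of the dispatcher.
Carrier-free (`V` any real normed space); nothing about the model (part 2 instantiates `f = frameLevel μ K`, `Γ_e = levelPoint μ K e` under `FrameOK` with the landed
rows and the curvature floor `curvCoeff ≥ (3/200)u_min²`); nothing asserts (C), K3 or superconductivity.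
References: FST II CPAM 51 (1998) Lemma 2.1, §3 [cite: FeldmanSalmhoferTrubowitz1998]; Salmhofer 1999 §4.5.3 [cite: Salmhofer1999].
-/

noncomputable section

namespace Summit.HubbardSuperconductivity.HubbardSuperconductivity.Theorems.C4a

set_option linter.dupNamespace false -- summit = problem name (single-conjunct summit), D-0017
set_option maxSynthPendingDepth 3 -- nested operator-norm instances (third Fréchet derivatives)

open Real Set
open Summit.HubbardSuperconductivity.HubbardSuperconductivity.Theorems.PerturbedFermiCurve

section Abstract

variable {V : Type*} [NormedAddCommGroup V] [NormedSpace ℝ V]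

/-! ## §1 The second derivative of a two-curve composition along a segment -/

/-- Affine reparametrisation: `∂ⁿ_s Γ(a + u·s) = uⁿ • Γ⁽ⁿ⁾(a + u·s)`. [folklore] -/
theorem iteratedDeriv_comp_const_add_mul {Γ : ℝ → V} {n : ℕ} (hΓ : ContDiff ℝ n Γ) (a u s : ℝ) :
    iteratedDeriv n (fun s : ℝ => Γ (a + u * s)) s = u ^ n • iteratedDeriv n Γ (a + u * s) := by
  have hsh : ContDiff ℝ n (fun y : ℝ => Γ (a + y)) := hΓ.comp (contDiff_const.add contDiff_id)
  have h1 : (fun s : ℝ => Γ (a + u * s)) = fun s : ℝ => (fun y : ℝ => Γ (a + y)) (u * s) := rfl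
  rw [h1, iteratedDeriv_comp_const_smul hsh u]
  simp only [iteratedDeriv_comp_const_add]

/-- `s ↦ c + (Γ₁(a₁ + u s) − Γ₂(a₂ + v s))` is `C⁴`. -/
theorem contDiff_two_curves {Γ₁ Γ₂ : ℝ → V} (hΓ₁ : ContDiff ℝ 4 Γ₁) (hΓ₂ : ContDiff ℝ 4 Γ₂) (c : V) (a₁ a₂ u v : ℝ) :
    ContDiff ℝ 4 (fun s : ℝ => c + (Γ₁ (a₁ + u * s) - Γ₂ (a₂ + v * s))) :=
  contDiff_const.add ((hΓ₁.comp (contDiff_const.add (contDiff_const.mul contDiff_id))).sub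
    (hΓ₂.comp (contDiff_const.add (contDiff_const.mul contDiff_id))))

/-- The jets of the two-curve path: `∂ʲ_s [c + Γ₁(a₁+us) − Γ₂(a₂+vs)] = uʲ•Γ₁⁽ʲ⁾ − vʲ•Γ₂⁽ʲ⁾` for `j = 1, 2`. [folklore] -/
theorem iteratedDeriv_two_curves {Γ₁ Γ₂ : ℝ → V} (hΓ₁ : ContDiff ℝ 4 Γ₁) (hΓ₂ : ContDiff ℝ 4 Γ₂) (c : V) (a₁ a₂ u v : ℝ) {j : ℕ}
    (hj : 0 < j) (hj4 : j ≤ 4) (s : ℝ) :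
    iteratedDeriv j (fun s : ℝ => c + (Γ₁ (a₁ + u * s) - Γ₂ (a₂ + v * s))) s =
      u ^ j • iteratedDeriv j Γ₁ (a₁ + u * s) - v ^ j • iteratedDeriv j Γ₂ (a₂ + v * s) := by
  have hj' : (j : WithTop ℕ∞) ≤ 4 := by exact_mod_cast hj4
  have h₁ : ContDiff ℝ j (fun s : ℝ => Γ₁ (a₁ + u * s)) := (hΓ₁.of_le hj').comp (contDiff_const.add (contDiff_const.mul contDiff_id))
  have h₂ : ContDiff ℝ j (fun s : ℝ => Γ₂ (a₂ + v * s)) := (hΓ₂.of_le hj').comp (contDiff_const.add (contDiff_const.mul contDiff_id))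
  rw [iteratedDeriv_const_add hj c, iteratedDeriv_fun_sub h₁.contDiffAt h₂.contDiffAt,
    iteratedDeriv_comp_const_add_mul (hΓ₁.of_le hj'), iteratedDeriv_comp_const_add_mul (hΓ₂.of_le hj')]

/-- **THE SECOND DERIVATIVE OF A TWO-CURVE COMPOSITION**: `∂ₛ² f(c + Γ₁(a₁+us) − Γ₂(a₂+vs)) = D²f(P)[w′,w′] + Df(P)[w″]` with `P` the path point,
`w′ = u•Γ₁′(a₁+us) − v•Γ₂′(a₂+vs)`, `w″ = u²•Γ₁″(a₁+us) − v²•Γ₂″(a₂+vs)`. [folklore] -/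
theorem iteratedDeriv_two_comp_two_curves {f : V → ℝ} (hf : ContDiff ℝ 4 f) {Γ₁ Γ₂ : ℝ → V} (hΓ₁ : ContDiff ℝ 4 Γ₁) (hΓ₂ : ContDiff ℝ 4 Γ₂)
    (c : V) (a₁ a₂ u v s : ℝ) :
    iteratedDeriv 2 (fun s : ℝ => f (c + (Γ₁ (a₁ + u * s) - Γ₂ (a₂ + v * s)))) s =
      fderiv ℝ (fderiv ℝ f) (c + (Γ₁ (a₁ + u * s) - Γ₂ (a₂ + v * s)))
          (u • iteratedDeriv 1 Γ₁ (a₁ + u * s) - v • iteratedDeriv 1 Γ₂ (a₂ + v * s))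
          (u • iteratedDeriv 1 Γ₁ (a₁ + u * s) - v • iteratedDeriv 1 Γ₂ (a₂ + v * s)) +
        fderiv ℝ f (c + (Γ₁ (a₁ + u * s) - Γ₂ (a₂ + v * s)))
          (u ^ 2 • iteratedDeriv 2 Γ₁ (a₁ + u * s) - v ^ 2 • iteratedDeriv 2 Γ₂ (a₂ + v * s)) := by
  have hc := contDiff_two_curves hΓ₁ hΓ₂ c a₁ a₂ u v
  have h := iteratedDeriv_two_comp_eq hf hc s
  rw [show (f ∘ fun s : ℝ => c + (Γ₁ (a₁ + u * s) - Γ₂ (a₂ + v * s))) = fun s => f (c + (Γ₁ (a₁ + u * s) - Γ₂ (a₂ + v * s))) from rfl] at h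
  rw [h, iteratedDeriv_two_curves hΓ₁ hΓ₂ c a₁ a₂ u v one_pos (by norm_num), iteratedDeriv_two_curves hΓ₁ hΓ₂ c a₁ a₂ u v two_pos (by norm_num)]
  simp only [pow_one]

/-! ## §2 Comparison with the antipodal reference jet on the zero level -/

/-- **The antipodal reference value.**  On the zero level (`D²f(q)[τ,τ] + Df(q)[ν] = 0`, `q = Γ₀ψ`, `τ = Γ₀′ψ`, `ν = Γ₀″ψ`) the order-2 chain expression at the
jet `(q; −(u+v)•τ, −(u²+v²)•ν)` equals `Q·(2u² + 2uv + 2v²)`, `Q = D²f(q)[τ,τ]`. -/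
theorem antipodal_reference_jet_eq {f : V → ℝ} (q τ ν : V) (u v : ℝ)
    (href : fderiv ℝ (fderiv ℝ f) q τ τ + fderiv ℝ f q ν = 0) :
    fderiv ℝ (fderiv ℝ f) q ((-(u + v)) • τ) ((-(u + v)) • τ) + fderiv ℝ f q ((-(u ^ 2 + v ^ 2)) • ν) =
      fderiv ℝ (fderiv ℝ f) q τ τ * (2 * u ^ 2 + 2 * u * v + 2 * v ^ 2) := by
  simp only [map_smul, smul_apply, smul_eq_mul]
  have h : fderiv ℝ f q ν = -fderiv ℝ (fderiv ℝ f) q τ τ := by linarith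
  rw [h]; ring

/-- **THE JOINT SECOND DERIVATIVE AGAINST THE ANTIPODAL REFERENCE JET.**  `f ∈ C⁴` with `‖Df‖ ≤ K₁`, `‖D²f‖ ≤ K₂`, `‖D³f‖ ≤ K₃`; `Γ₁, Γ₂, Γ₀ ∈ C⁴`,
`f ∘ Γ₀ ≡ 0`; sizes `‖Γ₁′‖, ‖Γ₂′‖ ≤ D₁`, `‖Γ₀′ψ‖ ≤ D₁`, `‖Γ₁″‖, ‖Γ₂″‖ ≤ D₂`; at the path point the DISPLACEMENT ROWS `‖P − Γ₀ψ‖ ≤ Δ`,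
`‖Γ₁′(a₁+us) + Γ₀′ψ‖ ≤ δ`, `‖Γ₂′(a₂+vs) − Γ₀′ψ‖ ≤ δ`, `‖Γ₁″(a₁+us) + Γ₀″ψ‖ ≤ η`, `‖Γ₂″(a₂+vs) − Γ₀″ψ‖ ≤ η`.  THEN
`|∂ₛ² f(c + Γ₁(a₁+us) − Γ₂(a₂+vs)) − Q(2u²+2uv+2v²)| ≤ (2K₃ΔD₁² + 4K₂δD₁ + K₂ΔD₂ + K₁η)·(u² + v²)`, `Q = D²f(Γ₀ψ)[Γ₀′ψ,Γ₀′ψ]`. -/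
theorem abs_iteratedDeriv_two_two_curves_sub_le {f : V → ℝ} (hf : ContDiff ℝ 4 f) {K₁ K₂ K₃ : ℝ} (hK₁ : ∀ x, ‖fderiv ℝ f x‖ ≤ K₁)
    (hK₂ : ∀ x, ‖iteratedFDeriv ℝ 2 f x‖ ≤ K₂) (hK₃ : ∀ x, ‖iteratedFDeriv ℝ 3 f x‖ ≤ K₃)
    {Γ₁ Γ₂ Γ₀ : ℝ → V} (hΓ₁ : ContDiff ℝ 4 Γ₁) (hΓ₂ : ContDiff ℝ 4 Γ₂) (hΓ₀ : ContDiff ℝ 4 Γ₀) (hΓ₀0 : ∀ s, f (Γ₀ s) = 0)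
    {D₁ D₂ : ℝ} (hD₁ : ∀ s, ‖iteratedDeriv 1 Γ₁ s‖ ≤ D₁) (hD₁' : ∀ s, ‖iteratedDeriv 1 Γ₂ s‖ ≤ D₁) (ψ : ℝ) (hD₁₀ : ‖iteratedDeriv 1 Γ₀ ψ‖ ≤ D₁)
    (hD₂ : ∀ s, ‖iteratedDeriv 2 Γ₁ s‖ ≤ D₂) (hD₂' : ∀ s, ‖iteratedDeriv 2 Γ₂ s‖ ≤ D₂)
    (c : V) (a₁ a₂ u v s : ℝ) {Δ δ η : ℝ}
    (hΔ : ‖c + (Γ₁ (a₁ + u * s) - Γ₂ (a₂ + v * s)) - Γ₀ ψ‖ ≤ Δ)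
    (hδ₁ : ‖iteratedDeriv 1 Γ₁ (a₁ + u * s) + iteratedDeriv 1 Γ₀ ψ‖ ≤ δ) (hδ₂ : ‖iteratedDeriv 1 Γ₂ (a₂ + v * s) - iteratedDeriv 1 Γ₀ ψ‖ ≤ δ)
    (hη₁ : ‖iteratedDeriv 2 Γ₁ (a₁ + u * s) + iteratedDeriv 2 Γ₀ ψ‖ ≤ η) (hη₂ : ‖iteratedDeriv 2 Γ₂ (a₂ + v * s) - iteratedDeriv 2 Γ₀ ψ‖ ≤ η) :
    |iteratedDeriv 2 (fun s : ℝ => f (c + (Γ₁ (a₁ + u * s) - Γ₂ (a₂ + v * s)))) s -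
        fderiv ℝ (fderiv ℝ f) (Γ₀ ψ) (iteratedDeriv 1 Γ₀ ψ) (iteratedDeriv 1 Γ₀ ψ) * (2 * u ^ 2 + 2 * u * v + 2 * v ^ 2)| ≤
      (2 * K₃ * Δ * D₁ ^ 2 + 4 * K₂ * δ * D₁ + K₂ * Δ * D₂ + K₁ * η) * (u ^ 2 + v ^ 2) := by
  have hK₁0 : 0 ≤ K₁ := (norm_nonneg _).trans (hK₁ (Γ₀ ψ))
  have hK₂0 : 0 ≤ K₂ := (norm_nonneg _).trans (hK₂ (Γ₀ ψ))
  have hK₃0 : 0 ≤ K₃ := (norm_nonneg _).trans (hK₃ (Γ₀ ψ))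
  have hD₁0 : 0 ≤ D₁ := (norm_nonneg _).trans hD₁₀
  have hD₂0 : 0 ≤ D₂ := (norm_nonneg _).trans (hD₂ 0)
  have hΔ0 : 0 ≤ Δ := (norm_nonneg _).trans hΔ
  have hδ0 : 0 ≤ δ := (norm_nonneg _).trans hδ₁
  have hη0 : 0 ≤ η := (norm_nonneg _).trans hη₁
  have href := fderiv_two_add_fderiv_levelCurve_eq_zero hf hΓ₀ hΓ₀0 ψ
  rw [iteratedDeriv_two_comp_two_curves hf hΓ₁ hΓ₂ c a₁ a₂ u v s,
    ← antipodal_reference_jet_eq (Γ₀ ψ) (iteratedDeriv 1 Γ₀ ψ) (iteratedDeriv 2 Γ₀ ψ) u v href]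
  refine (abs_jet_two_sub_le hf hK₁ hK₂ hK₃ _ _ _ _ _ _).trans ?_
  -- names
  set P : V := c + (Γ₁ (a₁ + u * s) - Γ₂ (a₂ + v * s)) with hP
  set q : V := Γ₀ ψ with hq
  set τ : V := iteratedDeriv 1 Γ₀ ψ with hτ
  set ν : V := iteratedDeriv 2 Γ₀ ψ with hν
  set g₁ : V := iteratedDeriv 1 Γ₁ (a₁ + u * s) with hg₁
  set g₂ : V := iteratedDeriv 1 Γ₂ (a₂ + v * s) with hg₂
  set h₁ : V := iteratedDeriv 2 Γ₁ (a₁ + u * s) with hh₁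
  set h₂ : V := iteratedDeriv 2 Γ₂ (a₂ + v * s) with hh₂
  -- sizes of the jets
  have hw1 : ‖u • g₁ - v • g₂‖ ≤ (|u| + |v|) * D₁ := by
    refine (norm_sub_le _ _).trans ?_
    rw [norm_smul, norm_smul, Real.norm_eq_abs, Real.norm_eq_abs, add_mul]
    exact add_le_add (mul_le_mul_of_nonneg_left (hD₁ _) (abs_nonneg _)) (mul_le_mul_of_nonneg_left (hD₁' _) (abs_nonneg _))
  have hv1 : ‖(-(u + v)) • τ‖ ≤ (|u| + |v|) * D₁ := by
    rw [norm_smul, Real.norm_eq_abs, abs_neg]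
    exact mul_le_mul (abs_add_le _ _) hD₁₀ (norm_nonneg _) (by positivity)
  have hw2 : ‖u ^ 2 • h₁ - v ^ 2 • h₂‖ ≤ (u ^ 2 + v ^ 2) * D₂ := by
    refine (norm_sub_le _ _).trans ?_
    rw [norm_smul, norm_smul, Real.norm_eq_abs, Real.norm_eq_abs, abs_of_nonneg (sq_nonneg u), abs_of_nonneg (sq_nonneg v), add_mul]
    exact add_le_add (mul_le_mul_of_nonneg_left (hD₂ _) (sq_nonneg _)) (mul_le_mul_of_nonneg_left (hD₂' _) (sq_nonneg _))
  have hd1 : ‖u • g₁ - v • g₂ - (-(u + v)) • τ‖ ≤ (|u| + |v|) * δ := by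
    have he : u • g₁ - v • g₂ - (-(u + v)) • τ = u • (g₁ + τ) - v • (g₂ - τ) := by
      simp only [smul_add, smul_sub, neg_smul, add_smul]; abel
    rw [he]
    refine (norm_sub_le _ _).trans ?_
    rw [norm_smul, norm_smul, Real.norm_eq_abs, Real.norm_eq_abs, add_mul]
    exact add_le_add (mul_le_mul_of_nonneg_left hδ₁ (abs_nonneg _)) (mul_le_mul_of_nonneg_left hδ₂ (abs_nonneg _))
  have hd2 : ‖u ^ 2 • h₁ - v ^ 2 • h₂ - (-(u ^ 2 + v ^ 2)) • ν‖ ≤ (u ^ 2 + v ^ 2) * η := by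
    have he : u ^ 2 • h₁ - v ^ 2 • h₂ - (-(u ^ 2 + v ^ 2)) • ν = u ^ 2 • (h₁ + ν) - v ^ 2 • (h₂ - ν) := by
      simp only [smul_add, smul_sub, neg_smul, add_smul]; abel
    rw [he]
    refine (norm_sub_le _ _).trans ?_
    rw [norm_smul, norm_smul, Real.norm_eq_abs, Real.norm_eq_abs, abs_of_nonneg (sq_nonneg u), abs_of_nonneg (sq_nonneg v), add_mul]
    exact add_le_add (mul_le_mul_of_nonneg_left hη₁ (sq_nonneg _)) (mul_le_mul_of_nonneg_left hη₂ (sq_nonneg _))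
  -- the four terms
  have huv : (|u| + |v|) ^ 2 ≤ 2 * (u ^ 2 + v ^ 2) := by
    have h1 : |u| ^ 2 = u ^ 2 := sq_abs u
    have h2 : |v| ^ 2 = v ^ 2 := sq_abs v
    nlinarith [sq_nonneg (|u| - |v|), h1, h2]
  have hsum0 : 0 ≤ |u| + |v| := by positivity
  have t1 : K₃ * ‖P - q‖ * ‖u • g₁ - v • g₂‖ ^ 2 ≤ 2 * K₃ * Δ * D₁ ^ 2 * (u ^ 2 + v ^ 2) := by
    have h1 : ‖u • g₁ - v • g₂‖ ^ 2 ≤ ((|u| + |v|) * D₁) ^ 2 := pow_le_pow_left₀ (norm_nonneg _) hw1 2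
    calc K₃ * ‖P - q‖ * ‖u • g₁ - v • g₂‖ ^ 2 ≤ K₃ * Δ * ((|u| + |v|) * D₁) ^ 2 :=
          mul_le_mul (mul_le_mul_of_nonneg_left hΔ hK₃0) h1 (sq_nonneg _) (mul_nonneg hK₃0 hΔ0)
      _ = K₃ * Δ * D₁ ^ 2 * (|u| + |v|) ^ 2 := by ring
      _ ≤ K₃ * Δ * D₁ ^ 2 * (2 * (u ^ 2 + v ^ 2)) := mul_le_mul_of_nonneg_left huv (by positivity)
      _ = 2 * K₃ * Δ * D₁ ^ 2 * (u ^ 2 + v ^ 2) := by ring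
  have t2 : K₂ * ‖u • g₁ - v • g₂ - (-(u + v)) • τ‖ * (‖u • g₁ - v • g₂‖ + ‖(-(u + v)) • τ‖) ≤ 4 * K₂ * δ * D₁ * (u ^ 2 + v ^ 2) := by
    have h1 : ‖u • g₁ - v • g₂‖ + ‖(-(u + v)) • τ‖ ≤ 2 * ((|u| + |v|) * D₁) := by linarith [hw1, hv1]
    calc K₂ * ‖u • g₁ - v • g₂ - (-(u + v)) • τ‖ * (‖u • g₁ - v • g₂‖ + ‖(-(u + v)) • τ‖)
        ≤ K₂ * ((|u| + |v|) * δ) * (2 * ((|u| + |v|) * D₁)) :=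
          mul_le_mul (mul_le_mul_of_nonneg_left hd1 hK₂0) h1 (by positivity) (by positivity)
      _ = 2 * K₂ * δ * D₁ * (|u| + |v|) ^ 2 := by ring
      _ ≤ 2 * K₂ * δ * D₁ * (2 * (u ^ 2 + v ^ 2)) := mul_le_mul_of_nonneg_left huv (by positivity)
      _ = 4 * K₂ * δ * D₁ * (u ^ 2 + v ^ 2) := by ring
  have t3 : K₂ * ‖P - q‖ * ‖u ^ 2 • h₁ - v ^ 2 • h₂‖ ≤ K₂ * Δ * D₂ * (u ^ 2 + v ^ 2) := by
    calc K₂ * ‖P - q‖ * ‖u ^ 2 • h₁ - v ^ 2 • h₂‖ ≤ K₂ * Δ * ((u ^ 2 + v ^ 2) * D₂) :=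
          mul_le_mul (mul_le_mul_of_nonneg_left hΔ hK₂0) hw2 (norm_nonneg _) (mul_nonneg hK₂0 hΔ0)
      _ = K₂ * Δ * D₂ * (u ^ 2 + v ^ 2) := by ring
  have t4 : K₁ * ‖u ^ 2 • h₁ - v ^ 2 • h₂ - (-(u ^ 2 + v ^ 2)) • ν‖ ≤ K₁ * η * (u ^ 2 + v ^ 2) := by
    calc K₁ * ‖u ^ 2 • h₁ - v ^ 2 • h₂ - (-(u ^ 2 + v ^ 2)) • ν‖ ≤ K₁ * ((u ^ 2 + v ^ 2) * η) := mul_le_mul_of_nonneg_left hd2 hK₁0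
      _ = K₁ * η * (u ^ 2 + v ^ 2) := by ring
  have htot : 2 * K₃ * Δ * D₁ ^ 2 * (u ^ 2 + v ^ 2) + 4 * K₂ * δ * D₁ * (u ^ 2 + v ^ 2) + K₂ * Δ * D₂ * (u ^ 2 + v ^ 2) + K₁ * η * (u ^ 2 + v ^ 2) =
      (2 * K₃ * Δ * D₁ ^ 2 + 4 * K₂ * δ * D₁ + K₂ * Δ * D₂ + K₁ * η) * (u ^ 2 + v ^ 2) := by ring
  rw [← htot]
  linarith [t1, t2, t3, t4]

/-! ## §3 The robust Schur floor of the reference form `Q(2u² + 2uv + 2v²)` -/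

/-- **ROBUST SCHUR FLOOR.**  `0 < Q`, `0 ≤ ε ≤ 3Q/2`, `|T − Q(2u²+2uv+2v²)| ≤ ε(u²+v²)` ⟹ `(3Q/2 − 2ε)·u² ≤ T`.  (The exact Schur complement of
`[[2Q, Q],[Q, 2Q]]` is `3Q/2`; the perturbed form `(Q/2+ε)u² + 2Quv + (2Q−ε)v²` stays positive semidefinite because `(Q/2+ε)(2Q−ε) − Q² = ε(3Q/2 − ε) ≥ 0`.) -/
theorem robust_schur_floor {Q ε T u v : ℝ} (hQ : 0 < Q) (hε : 0 ≤ ε) (hεQ : ε ≤ 3 / 2 * Q)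
    (hT : |T - Q * (2 * u ^ 2 + 2 * u * v + 2 * v ^ 2)| ≤ ε * (u ^ 2 + v ^ 2)) :
    (3 / 2 * Q - 2 * ε) * u ^ 2 ≤ T := by
  have h1 : Q * (2 * u ^ 2 + 2 * u * v + 2 * v ^ 2) - ε * (u ^ 2 + v ^ 2) ≤ T := by
    have := (abs_le.1 hT).1; linarith
  -- the perturbed form is nonnegative: multiply by `2Q − ε > 0`
  have hc : 0 < 2 * Q - ε := by linarith
  have hsos : (2 * Q - ε) * ((Q / 2 + ε) * u ^ 2 + 2 * Q * u * v + (2 * Q - ε) * v ^ 2) =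
      ((2 * Q - ε) * v + Q * u) ^ 2 + ε * (3 / 2 * Q - ε) * u ^ 2 := by ring
  have hnn : 0 ≤ (2 * Q - ε) * ((Q / 2 + ε) * u ^ 2 + 2 * Q * u * v + (2 * Q - ε) * v ^ 2) := by
    rw [hsos]
    have h2 : 0 ≤ ε * (3 / 2 * Q - ε) * u ^ 2 := mul_nonneg (mul_nonneg hε (by linarith)) (sq_nonneg u)
    positivity
  have hform : 0 ≤ (Q / 2 + ε) * u ^ 2 + 2 * Q * u * v + (2 * Q - ε) * v ^ 2 := by
    by_contra hcon
    push Not at hcon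
    have := mul_neg_of_pos_of_neg hc hcon
    linarith
  nlinarith [h1, hform]

/-! ## §4 Joint strong convexity in the first variable from the rows -/

/-- **JOINT STRONG CONVEXITY OF THE TWO-CURVE COMPOSITION IN `ϑ`.**  `G (ϑ,φ) = f(c + Γ₁(ϑ+θ) − Γ₂(φ+θ))` (given as `hG`); `f ∈ C⁴` (`K₁,K₂,K₃`);
`Γ₁, Γ₂, Γ₀ ∈ C⁴`, `f ∘ Γ₀ ≡ 0`; sizes `D₁, D₂` as in §2; a reference angle `ψ` with `0 < Q = D²f(Γ₀ψ)[Γ₀′ψ,Γ₀′ψ]`; a CONVEX `S ⊆ ℝ×ℝ` on which the displacement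
rows hold uniformly: `‖c + Γ₁(ϑ+θ) − Γ₂(φ+θ) − Γ₀ψ‖ ≤ Δ`, `‖Γ₁′(ϑ+θ) + Γ₀′ψ‖ ≤ δ`, `‖Γ₂′(φ+θ) − Γ₀′ψ‖ ≤ δ`, `‖Γ₁″(ϑ+θ) + Γ₀″ψ‖ ≤ η`, `‖Γ₂″(φ+θ) − Γ₀″ψ‖ ≤ η`
(`(ϑ,φ) ∈ S`); budget `ε := 2K₃ΔD₁² + 4K₂δD₁ + K₂ΔD₂ + K₁η ≤ 3Q/2`.  THEN `(ϑ,φ) ↦ G(ϑ,φ) − (κ/2)ϑ²` is convex on `S` with `κ = 3Q/2 − 2ε` — the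
`hg` of `…C4aCausticTouchConvexity.convexOn_partialMin_sub_sq` (hence the dispatcher's `hφ` for the caustic offset `δ₀ = min_φ G`). -/
theorem convexOn_sub_sq_of_two_curves {f : V → ℝ} (hf : ContDiff ℝ 4 f) {K₁ K₂ K₃ : ℝ} (hK₁ : ∀ x, ‖fderiv ℝ f x‖ ≤ K₁)
    (hK₂ : ∀ x, ‖iteratedFDeriv ℝ 2 f x‖ ≤ K₂) (hK₃ : ∀ x, ‖iteratedFDeriv ℝ 3 f x‖ ≤ K₃)
    {Γ₁ Γ₂ Γ₀ : ℝ → V} (hΓ₁ : ContDiff ℝ 4 Γ₁) (hΓ₂ : ContDiff ℝ 4 Γ₂) (hΓ₀ : ContDiff ℝ 4 Γ₀) (hΓ₀0 : ∀ s, f (Γ₀ s) = 0)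
    {D₁ D₂ : ℝ} (hD₁ : ∀ s, ‖iteratedDeriv 1 Γ₁ s‖ ≤ D₁) (hD₁' : ∀ s, ‖iteratedDeriv 1 Γ₂ s‖ ≤ D₁) {ψ : ℝ} (hD₁₀ : ‖iteratedDeriv 1 Γ₀ ψ‖ ≤ D₁)
    (hD₂ : ∀ s, ‖iteratedDeriv 2 Γ₁ s‖ ≤ D₂) (hD₂' : ∀ s, ‖iteratedDeriv 2 Γ₂ s‖ ≤ D₂)
    {c : V} {θ : ℝ} {G : ℝ × ℝ → ℝ} (hG : ∀ x : ℝ × ℝ, G x = f (c + (Γ₁ (x.1 + θ) - Γ₂ (x.2 + θ))))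
    {S : Set (ℝ × ℝ)} (hS : Convex ℝ S) {Δ δ η : ℝ}
    (hΔ : ∀ x ∈ S, ‖c + (Γ₁ (x.1 + θ) - Γ₂ (x.2 + θ)) - Γ₀ ψ‖ ≤ Δ)
    (hδ₁ : ∀ x ∈ S, ‖iteratedDeriv 1 Γ₁ (x.1 + θ) + iteratedDeriv 1 Γ₀ ψ‖ ≤ δ)
    (hδ₂ : ∀ x ∈ S, ‖iteratedDeriv 1 Γ₂ (x.2 + θ) - iteratedDeriv 1 Γ₀ ψ‖ ≤ δ)
    (hη₁ : ∀ x ∈ S, ‖iteratedDeriv 2 Γ₁ (x.1 + θ) + iteratedDeriv 2 Γ₀ ψ‖ ≤ η)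
    (hη₂ : ∀ x ∈ S, ‖iteratedDeriv 2 Γ₂ (x.2 + θ) - iteratedDeriv 2 Γ₀ ψ‖ ≤ η)
    (hQ : 0 < fderiv ℝ (fderiv ℝ f) (Γ₀ ψ) (iteratedDeriv 1 Γ₀ ψ) (iteratedDeriv 1 Γ₀ ψ))
    (hbudget : 2 * K₃ * Δ * D₁ ^ 2 + 4 * K₂ * δ * D₁ + K₂ * Δ * D₂ + K₁ * η ≤
      3 / 2 * fderiv ℝ (fderiv ℝ f) (Γ₀ ψ) (iteratedDeriv 1 Γ₀ ψ) (iteratedDeriv 1 Γ₀ ψ)) :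
    ConvexOn ℝ S (fun x : ℝ × ℝ => G x -
      (3 / 2 * fderiv ℝ (fderiv ℝ f) (Γ₀ ψ) (iteratedDeriv 1 Γ₀ ψ) (iteratedDeriv 1 Γ₀ ψ) -
        2 * (2 * K₃ * Δ * D₁ ^ 2 + 4 * K₂ * δ * D₁ + K₂ * Δ * D₂ + K₁ * η)) / 2 * x.1 ^ 2) := by
  set Q : ℝ := fderiv ℝ (fderiv ℝ f) (Γ₀ ψ) (iteratedDeriv 1 Γ₀ ψ) (iteratedDeriv 1 Γ₀ ψ) with hQdef
  set ε : ℝ := 2 * K₃ * Δ * D₁ ^ 2 + 4 * K₂ * δ * D₁ + K₂ * Δ * D₂ + K₁ * η with hεdef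
  refine convexOn_sub_sq_of_line_deriv2 hS fun p hp q hq => ?_
  -- the segment function in two-curve form
  have hseg : (fun s : ℝ => G (p + s • (q - p))) =
      fun s : ℝ => f (c + (Γ₁ ((p.1 + θ) + (q.1 - p.1) * s) - Γ₂ ((p.2 + θ) + (q.2 - p.2) * s))) := by
    funext s
    rw [hG]
    have h1 : (p + s • (q - p)).1 + θ = (p.1 + θ) + (q.1 - p.1) * s := by
      simp only [Prod.fst_add, Prod.smul_fst, Prod.fst_sub, smul_eq_mul]; ring
    have h2 : (p + s • (q - p)).2 + θ = (p.2 + θ) + (q.2 - p.2) * s := by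
      simp only [Prod.snd_add, Prod.smul_snd, Prod.snd_sub, smul_eq_mul]; ring
    rw [h1, h2]
  rw [hseg]
  refine ⟨(hf.comp (contDiff_two_curves hΓ₁ hΓ₂ c _ _ _ _)).of_le (by norm_num), fun s hs => ?_⟩
  -- the rows at the segment point, which lies in `S`
  have hx : p + s • (q - p) ∈ S := hS.add_smul_sub_mem hp hq hs
  have e1 : (p + s • (q - p)).1 + θ = (p.1 + θ) + (q.1 - p.1) * s := by
    simp only [Prod.fst_add, Prod.smul_fst, Prod.fst_sub, smul_eq_mul]; ring
  have e2 : (p + s • (q - p)).2 + θ = (p.2 + θ) + (q.2 - p.2) * s := by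
    simp only [Prod.snd_add, Prod.smul_snd, Prod.snd_sub, smul_eq_mul]; ring
  have rΔ := hΔ _ hx; rw [e1, e2] at rΔ
  have rδ₁ := hδ₁ _ hx; rw [e1] at rδ₁
  have rδ₂ := hδ₂ _ hx; rw [e2] at rδ₂
  have rη₁ := hη₁ _ hx; rw [e1] at rη₁
  have rη₂ := hη₂ _ hx; rw [e2] at rη₂
  have hmain := abs_iteratedDeriv_two_two_curves_sub_le hf hK₁ hK₂ hK₃ hΓ₁ hΓ₂ hΓ₀ hΓ₀0 hD₁ hD₁' ψ hD₁₀ hD₂ hD₂' c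
    (p.1 + θ) (p.2 + θ) (q.1 - p.1) (q.2 - p.2) s rΔ rδ₁ rδ₂ rη₁ rη₂
  have hε0 : 0 ≤ ε := by
    have hK₁0 : 0 ≤ K₁ := (norm_nonneg _).trans (hK₁ (Γ₀ ψ))
    have hK₂0 : 0 ≤ K₂ := (norm_nonneg _).trans (hK₂ (Γ₀ ψ))
    have hK₃0 : 0 ≤ K₃ := (norm_nonneg _).trans (hK₃ (Γ₀ ψ))
    have hD₁0 : 0 ≤ D₁ := (norm_nonneg _).trans hD₁₀
    have hD₂0 : 0 ≤ D₂ := (norm_nonneg _).trans (hD₂ 0)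
    have hΔ0 : 0 ≤ Δ := (norm_nonneg _).trans rΔ
    have hδ0 : 0 ≤ δ := (norm_nonneg _).trans rδ₁
    have hη0 : 0 ≤ η := (norm_nonneg _).trans rη₁
    simp only [hεdef]; positivity
  exact robust_schur_floor (u := q.1 - p.1) (v := q.2 - p.2) hQ hε0 hbudget hmain

end Abstract

end Summit.HubbardSuperconductivity.HubbardSuperconductivity.Theorems.C4a

end
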